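import Summits.ABC.StewartYu.PadicTwistPMPack
import Summits.ABC.StewartYu.PadicTwistPMCoreBound
import Summits.ABC.StewartYu.PadicTwistPMEngine
import Summits.ABC.StewartYu.PadicTwistFinal
import HarnessLib

/-!
# Cell abc-stewartyu, provider B (xx): ± packs exist, THE ± CORE BOUND for every twist order, and the
# registered stub `stub_coreBoundPM` of crux `W80OneModFour` (stmt-ABC-19487)

`Summits/ABC/StewartYu/PadicTwistPMFinal.lean` — cell `abc-stewartyu` (seat p1-g5 executing p3-g2's brief
HANDOFF §p3 (5‴) under the planner's contingency 2026-08-26 10:32Z; theorems only, no named fact).  TWIN of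
p2's `PadicTwistFinal.lean` (provider A) for p3's ± machine: `twistCoreBoundPM_of_packs` (± packs for
`d ≥ 1` + the `d = 0` Liouville case `coreBound_of_d_zero_pm`), `packs_exist_pm` (the record is the data
with `ℓ = log p`, `Mcl = G ≤ p`; p1's envelope `U_le_Cw'`), `twistCoreBoundPM_holds` (`C m = 2·Cw m`), and
**`coreBoundPM_holds`** — literally the statement of the registered stub `stub_coreBoundPM` of p3's line
`parity-twist-w80`: `∃ C c₁, 1 ≤ c₁ ∧ (∀ m ≥ 1, 2 ≤ C m) ∧ (∀ m ≥ 1, C m ≤ c₁^m m^m) ∧ TwistCoreBoundPM C`.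
With p3's `engineW80One_of_coreBoundPM` and `YuNinetyW80.oneModFour_of_w80Engine` this closes the crux.

## References
* [Yu1990] K. Yu, Compositio Math. 74 (1990), Theorem 2.1 / Proposition 2.1.
* [Waldschmidt1980] M. Waldschmidt, Acta Arith. 37 (1980), Prop. 3.8.
-/

noncomputable section

open Finset Height
open Literature.NumberTheory.Transcendental

namespace Summit.ABC.StewartYu

namespace TwistSetup

variable {p : ℕ} [Fact p.Prime]

/-! ### ± packs give the ± core bound -/

/-- **± packs for every twisted set-up with `d ≥ 1` give the ± core bound** (any twist order `G ≤ p`,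
SIGNED Kummer; the case `d = 0` by Liouville, for `3 ≤ C 1`). [cite: Yu1990, Proposition 2.1]
[cite: Waldschmidt1980, Prop. 3.8] -/
theorem twistCoreBoundPM_of_packs {C : ℕ → ℝ} (hC1 : 3 ≤ C 1)
    (hpk : ∀ (p : ℕ) [Fact p.Prime] (S : TwistSetup p) (V : Fin S.d → ℝ) (Vθ Vmax W : ℝ), 1 ≤ S.d →
      S.G ≤ p →
      (∀ T : Finset (Fin (S.d + 1)), T.Nonempty →
        ¬ IsSquare (∏ i ∈ T, S.toQ.all i) ∧ ¬ IsSquare (-∏ i ∈ T, S.toQ.all i)) →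
      (∀ μ : Fin (S.d + 1) → ℤ, ∏ i, S.toQ.all i ^ μ i = 1 → μ = 0) →
      (∀ j, logHeight₁ (S.α j) ≤ V j) → logHeight₁ S.θ ≤ Vθ →
      (∀ j, Real.log p ≤ V j) → Real.log p ≤ Vθ → (∀ j, V j ≤ Vmax) → Vθ ≤ Vmax →
      (∀ j, Real.log (max 3 (|S.b j| : ℝ)) ≤ W) → Real.log (max 3 (|S.bθ| : ℝ)) ≤ W → Real.log p ≤ W →
      Nonempty (S.ParamPackPM (C (S.d + 1) * S.G * ((∏ j, V j / Real.log p) * (Vθ / Real.log p)) *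
        (W + Real.log (2 * Vmax)) * Real.log (2 * Vmax)))) :
    TwistCoreBoundPM C := by
  intro p _ S V Vθ Vmax W hGp hK hμ hV hVθ hVp hVθp hVm hVθm hW hWθ hWp
  rcases Nat.eq_zero_or_pos S.d with hd | hd
  · have hlast := hK {Fin.last S.d} ⟨_, Finset.mem_singleton_self _⟩
    rw [Finset.prod_singleton] at hlast
    unfold SetupQ.all at hlast
    rw [Fin.snoc_last] at hlast
    exact S.coreBound_of_d_zero_pm hd hlast.2 hC1 hlast.1 V Vθ Vmax W hVθ hVθp hVθm hWp
  · obtain ⟨pk⟩ := hpk p S V Vθ Vmax W hd hGp hK hμ hV hVθ hVp hVθp hVm hVθm hW hWθ hWp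
    exact not_le.mp (S.not_norm_Λ₀_le_of_paramPackPM pk)

/-- **± packs exist** for every twisted set-up with `d ≥ 1`, any twist order `G ≤ p`, signed-Kummer-free
generators, heights `≤ V`, floors `log p ≤ V ≤ Vmax`, `log p ≤ W`: the record is the data itself with
`ℓ = log p`, `Mcl = G`; exponent `P.Uℓ ≤ 2·Cw(d+1)·G·∏(Vⱼ/log p)(V_θ/log p)·(W + log 2Vmax)·log 2Vmax`.
[folklore] -/
theorem packs_exist_pm (S : TwistSetup p) (V : Fin S.d → ℝ) (Vθ Vmax W : ℝ) (hd : 1 ≤ S.d)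
    (hGp : S.G ≤ p)
    (hK : ∀ T : Finset (Fin (S.d + 1)), T.Nonempty →
      ¬ IsSquare (∏ i ∈ T, S.toQ.all i) ∧ ¬ IsSquare (-∏ i ∈ T, S.toQ.all i))
    (hV : ∀ j, Height.logHeight₁ (S.α j) ≤ V j) (hVθ : Height.logHeight₁ S.θ ≤ Vθ)
    (hVp : ∀ j, Real.log p ≤ V j) (hVθp : Real.log p ≤ Vθ) (hVm : ∀ j, V j ≤ Vmax) (hVθm : Vθ ≤ Vmax)
    (hW : ∀ j, Real.log (max 3 (|S.b j| : ℝ)) ≤ W) (hWθ : Real.log (max 3 (|S.bθ| : ℝ)) ≤ W)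
    (hWp : Real.log p ≤ W) :
    Nonempty (S.ParamPackPM ((2 * PadicW80Par.Cw (S.d + 1)) * S.G *
      ((∏ j, V j / Real.log p) * (Vθ / Real.log p)) * (W + Real.log (2 * Vmax)) * Real.log (2 * Vmax))) := by
  have hlog3 : (1 : ℝ) < Real.log 3 := by
    rw [Real.lt_log_iff_exp_lt (by norm_num)]
    have := Real.exp_one_lt_d9; norm_num at this; linarith
  have hlp : (1 : ℝ) ≤ Real.log p := hlog3.le.trans (Real.log_le_log (by norm_num) S.three_le_p)
  have hG1 : (1 : ℝ) ≤ S.G := by exact_mod_cast S.hG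
  have hGlog : Real.log S.G ≤ Real.log p :=
    Real.log_le_log (by exact_mod_cast S.hG) (by exact_mod_cast hGp)
  let P : PadicW80ParL S.d :=
    { V := V, Vm := Vmax, Vθ := Vθ, W := W, ℓ := Real.log p, Mcl := S.G
      hℓ := hlp, hVℓ := hVp, hVmax := hVm, hVθℓ := hVθp, hVθmax := hVθm, hWℓ := hWp
      hMcl := hG1, hMclℓ := hGlog, hd := hd }
  have pk := paramPackPMOf (P := P) (S.sizeHyp_of_logHeight hV hW hVθ hWθ) hK rfl rfl
  have hU : P.Uℓ ≤ (2 * PadicW80Par.Cw (S.d + 1)) * S.G *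
      ((∏ j, V j / Real.log p) * (Vθ / Real.log p)) * (W + Real.log (2 * Vmax)) * Real.log (2 * Vmax) := by
    have h := P.U_le_Cw'
    have e1 : (∏ j, P.nV j) * P.nVθ = (∏ j, V j / Real.log p) * (Vθ / Real.log p) := rfl
    have e2 : P.Mcl = (S.G : ℝ) := rfl
    have e3 : P.W = W := rfl
    have e4 : P.Vm = Vmax := rfl
    rw [e1, e2, e3, e4] at h
    calc P.Uℓ ≤ _ := h
      _ = _ := by ring
  exact ⟨pk.mono hU⟩

/-- **The ± core bound of the twisted machine holds for every twist order** with `C m = 2·Cw m = 2(2⁶⁹m)^m`.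
[folklore] -/
theorem twistCoreBoundPM_holds : TwistCoreBoundPM (fun m => 2 * PadicW80Par.Cw m) := by
  refine twistCoreBoundPM_of_packs (by show (3 : ℝ) ≤ 2 * PadicW80Par.Cw 1; unfold PadicW80Par.Cw; norm_num) ?_
  intro p _ S V Vθ Vmax W hd hGp hK _hμ hV hVθ hVp hVθp hVm hVθm hW hWθ hWp
  exact packs_exist_pm S V Vθ Vmax W hd hGp hK hV hVθ hVp hVθp hVm hVθm hW hWθ hWp

/-- **The ± core bound with admissible constants** (`C m = 2·Cw m`, `c₁ = 2⁷⁰`: `2 ≤ C m ≤ c₁^m m^m` for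
`m ≥ 1`) — literally the registered stub `stub_coreBoundPM` of the line `parity-twist-w80` of crux
`W80OneModFour` (stmt-ABC-19487); with p3's `engineW80One_of_coreBoundPM` it yields the Waldschmidt-shape twist
engine at `p ≡ 1 (mod 4)`. [folklore] -/
theorem coreBoundPM_holds : ∃ (C : ℕ → ℝ) (c₁ : ℝ), 1 ≤ c₁ ∧ (∀ m, 1 ≤ m → 2 ≤ C m) ∧
    (∀ m, 1 ≤ m → C m ≤ c₁ ^ m * (m : ℝ) ^ m) ∧ TwistCoreBoundPM C :=
  ⟨fun m => 2 * PadicW80Par.Cw m, 2 ^ 70, by norm_num,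
    fun m hm => by have := PadicW80Par.two_le_Cw hm; change 2 ≤ 2 * PadicW80Par.Cw m; linarith,
    fun m hm => two_mul_Cw_le_pow hm, twistCoreBoundPM_holds⟩

/-- **THE ± ENGINE** — the Waldschmidt-shape twist engine at `p ≡ 1 (mod 4)` for arbitrary rational
`p`-adic units (`C(m) ≤ (2⁷¹)^m m^m`): the hypothesis `hE` of p3's `YuNinetyW80.oneModFour_of_w80Engine`,
by p3's reduction `engineW80One_of_coreBoundPM`. [folklore] -/
theorem engineOneModFourW80 :
    ∃ (C : ℕ → ℝ) (c₁ : ℝ), 1 ≤ c₁ ∧ (∀ m, 0 ≤ C m ∧ C m ≤ c₁ ^ m * (m : ℝ) ^ m) ∧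
      ∀ (p : ℕ), p.Prime → p % 4 = 1 → ∀ (m : ℕ) (α : Fin m → ℚ) (b : Fin m → ℤ) (V : Fin m → ℝ)
        (Vmax W : ℝ),
        (∀ j, α j ≠ 0 ∧ padicValRat p (α j) = 0) →
        (∀ μ : Fin m → ℤ, ∏ j, α j ^ μ j = 1 → μ = 0) →
        (∀ T : Finset (Fin m), T.Nonempty → ¬ IsSquare (∏ j ∈ T, α j) ∧ ¬ IsSquare (-∏ j ∈ T, α j)) →
        (∀ j, Height.logHeight₁ (α j) ≤ V j) → (∀ j, Real.log p ≤ V j) → (∀ j, V j ≤ Vmax) →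
        b ≠ 0 → (∀ j, Real.log (max 3 (|b j| : ℝ)) ≤ W) → Real.log p ≤ W →
        (padicValRat p (∏ j, α j ^ b j - 1) : ℝ) ≤
          C m * p * (∏ j, V j / Real.log p) * (W + Real.log (2 * Vmax)) * Real.log (2 * Vmax) := by
  obtain ⟨C, c₁, hc₁, hC2, henv, hcore⟩ := coreBoundPM_holds
  exact engineW80One_of_coreBoundPM hc₁ hC2 henv hcore

end TwistSetup

end Summit.ABC.StewartYu

end
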